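import Summits.BirchSwinnertonDyer.BirchSwinnertonDyer.Theorems.SylvesterTwoHeegnerIndexCoupledTelescopeSelmerKappa
import Summits.BirchSwinnertonDyer.BirchSwinnertonDyer.Theorems.SylvesterTwoHeegnerIndexCoupledTelescopeCount
import Summits.BirchSwinnertonDyer.BirchSwinnertonDyer.Theorems.SylvesterTwoHeegnerIndexShaDescentOrderForm
import Literature.NumberTheory.EllipticCurves.VariableChangePointsMap
import Summits.BirchSwinnertonDyer.BirchSwinnertonDyer.Theses.SylvesterTwoHeegnerIndex
import Literature.NumberTheory.EllipticCurves.BSDRankZeroDensity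
import HarnessLib

/-!
# The COUPLED Cassels–Tate telescope, V-κ′ (HALVED TWIN of p704241): the CENSUS THEOREM —
# `stub_tailSeven` VERBATIM from the κ-NARROWED coupled leaves hT^κ(7)′ whose (T-L5) PROVENANCE
# CLAUSE IS HALVED, `Y ↦ 2 • (2^{M₀}·x₀ + T)` (bottom `Y′`, `2Y′ = Y`; planner D735/D736, VARIANT Q)

Crux `UpperOffV0HSYPlus` (stmt-BirchSwinnertonDyer-19804).  THIS FILE = `…CoupledTelescopeTailSevenKappa`
(p704241, edecfb0b64ad0c92) with EXACTLY ONE display clause changed — the provenance conjunct of `hT`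
reads `(VariableChange.pointEquivBaseChange B CB K Y) = (2 : ℤ) • (((2 ^ M₀ : ℕ) : ℤ) • x₀ + T)` — and
the theorem renamed `tailSeven_of_coupledTelescope_of_leaves_kappa_halved`; the PROOF IS BYTE-IDENTICAL
(the census proof discards the provenance conjuncts, `-, -, -`: TAIL(7) consumes only `x_ord`,
`c_one : cB 1 = 2^{M₀}•x`, `hM₀ : 2M₀ ≤ ord₂(qB·qA)` and the level-κ leaves — Σ N i ≤ M₀ by
`sum_le_M₀_of_coupledLeaves_kappa`, then LEMMA K0; kernel-checked beforehand as the planner's probe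
`bsd-cm-plan/g32/r7c_halved_probe.lean` 21289f40618f9f8d, rc 0).  WHY (memo
`Cruxes/UpperOffV0HSYPlus/MInfinityAtThree-g44.md` REV 2 911440113cd8cadd, census D736): at `p ≡ 7 (9)`
the rows' Kolyvagin family is the HALVED system `{Q_n}` (`P_n = 2Q_n`) with bottom `Y′ = Q₁`, `2Y′ = Y`,
so the display's `M₀` is `M₀(Y′) = M₀(Y) − 1` and the reading `2M₀ ≤ ord₂(qB·qA)` is sharp (D702);
consumed by the twin `…TailSevenOfResidueHalved` (RESIDUE 7′ ⇒ hT^κ(7)′) and, through it, by VARIANT Q's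
content stub `stub_residueSevenHalved` (D737).  Every other word of p704241's module docstring (the
κ-narrowing D596, the leaf list, McCallum 1991 §4 Prop. 4.7 / §5 Lemma 5.3 / Thm. 5.4 / Cor. 5.6,
MEMO-bsd-cm-two §57.2, §59, §64) applies verbatim.  HONEST LABEL: a CONDITIONAL closure of
`stub_tailSeven` modulo the displayed leaves hT^κ(7)′; the ledger stub is NOT closed; the leaves (incl.
the registered research input `stub_levelFixingSeven`) are the rows' and NOT claimed; nothing asserted on
19804; no label moves; X12.CMAtTwo NOT proved; BSD not claimed for any curve.  Theorem-only, debt 0.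
-/


-- every Summits module is named `Summit.<Summit>.<Problem>…`: the duplicated component is by design
set_option linter.dupNamespace false
set_option autoImplicit false

noncomputable section

open scoped Classical

namespace Summit.BirchSwinnertonDyer.BirchSwinnertonDyer.Theorems.SylvesterTwoCoupledTelescope

open Literature.NumberTheory.EllipticCurves Literature.NumberTheory.EllipticCurves.KolyvaginDescent


/-! ## §6κ. THE CENSUS THEOREM: `stub_tailSeven` VERBATIM from the κ-NARROWED coupled leaves at level `2^κ·2^κ` -/

section TailKappa

open WeierstrassCurve NumberField IsDedekindDomain Literature.NumberTheory.EllipticCurves.HuShuYin2019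
open Summit.BirchSwinnertonDyer.BirchSwinnertonDyer.Theses.SylvesterTwoHeegnerIndex
  hiding HSYPointTwoDivisibleSevenModNine

set_option maxHeartbeats 400000 in
/-- **CENSUS THEOREM for `stub_tailSeven`, κ-NARROWED leaves with the PROVENANCE HALVED (hT^κ(7)′,
planner D735/D736; twin of `tailSeven_of_coupledTelescope_of_leaves_kappa`, p704241, whose proof this is
byte-for-byte): the TAIL at `p ≡ 7 (9)` VERBATIM from the coupled leaves at the literal Selmer level
`2^κ·2^κ` in the tail's own currency, the (T-L5) clause reading `Y ↦ 2 • (2^{M₀}·x₀ + T)` (bottom `Y′`,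
`2Y′ = Y`)** (module docstring).  `hT` = p699428's display with binder `κ` (for `M`, `M := 2κ`), `M₀ ≤ κ`, value
clauses on `κ ≤ j`, `N' ≤ κ` only, room `N i ≤ κ`; all other leaves byte-identical: (T-L5)
`Y ↦ 2 • (2^{M₀}·x₀ + T)` (HALVED), `x = δ_{2^κ·2^κ} x₀` of order `2^{2κ}`, `c_B 1 = 2^{M₀} x`, reading
`2M₀ ≤ ord₂(qB·qA)`; (T-L4) coisotropic `D_X` covered by the `𝒪`-span of the lifts.  CONCLUSION =
`stub_tailSeven`'s statement VERBATIM (`Lines/coupled_variantM.lean` 406ca288e244d392, l.205–215).  The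
stub is NOT closed; nothing asserted on 19804; BSD not claimed for any curve.
[cite: McCallumLMS1991, §1 Theorem; Prop. 4.7; Thm. 5.4 (proof, p. 288), Cor. 5.6] -/
theorem tailSeven_of_coupledTelescope_of_leaves_kappa_halved
    (hT : PublishedFactsTwoPlus →
      ∀ (p : ℕ), p.Prime → p % 9 = 7 → (¬ ∃ x : ZMod p, x ^ 3 = 3) →
        ∀ (A B : WeierstrassCurve ℚ) [A.IsElliptic] [A.IsGloballyMinimal] [B.IsElliptic]
          [B.IsGloballyMinimal], (∃ C : VariableChange ℚ, C • B = HuShuYin2019.cubeSumCurve (p : ℚ)) →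
          (∃ C : VariableChange ℚ, C • A = HuShuYin2019.cubeSumCurve (3 * (p : ℚ) ^ 2)) →
          4 < Nat.card (AddCommGroup.primaryComponent B.sha 2) *
              Nat.card (AddCommGroup.primaryComponent A.sha 2) →
          ∀ (qB qA : ℚ), shaAn B = (qB : ℂ) → shaAn A = (qA : ℂ) → qB * qA ≠ 0 →
          ∀ (K : Type) [Field K] [NumberField K] (ω : K), ω ^ 2 + ω + 1 = 0 →
            Module.finrank ℚ K = 2 →
          ∀ (CB : VariableChange ℚ) (hCB : CB • B = HuShuYin2019.cubeSumCurve (p : ℚ))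
            (P : B.toAffine.Point) (Y : (B.baseChange K).toAffine.Point),
            ¬ IsOfFinAddOrder (WeierstrassCurve.QuadraticDescent.incl K B P) →
            (∀ Q : B.toAffine.Point, ∃ m : ℤ, IsOfFinAddOrder
              (WeierstrassCurve.QuadraticDescent.incl K B Q -
                m • WeierstrassCurve.QuadraticDescent.incl K B P)) →
            ((qB * qA : ℚ) : ℝ) *
                WeierstrassCurve.Affine.Point.canonicalHeight (WeierstrassCurve.QuadraticDescent.incl K B P) =
              (2 : ℝ) ^ (if p % 9 = 4 then (0 : ℤ) else -2) *
                WeierstrassCurve.Affine.Point.canonicalHeight Y →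
          ∃ (κ M₀ K₀ : ℕ) (Kol : ℕ → Prop)
            (wA : galH1Torsion ((cubeSumCurve (3 * (p : ℚ) ^ 2)).baseChange K) ((2 ^ κ * 2 ^ κ : ℕ) : ℤ) →+
              galH1Torsion ((cubeSumCurve (3 * (p : ℚ) ^ 2)).baseChange K) ((2 ^ κ * 2 ^ κ : ℕ) : ℤ))
            (wB : galH1Torsion ((cubeSumCurve (p : ℚ)).baseChange K) ((2 ^ κ * 2 ^ κ : ℕ) : ℤ) →+
              galH1Torsion ((cubeSumCurve (p : ℚ)).baseChange K) ((2 ^ κ * 2 ^ κ : ℕ) : ℤ))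
            (AdmA : Set (galH1Torsion ((cubeSumCurve (3 * (p : ℚ) ^ 2)).baseChange K) ((2 ^ κ * 2 ^ κ : ℕ) : ℤ)))
            (AdmB : Set (galH1Torsion ((cubeSumCurve (p : ℚ)).baseChange K) ((2 ^ κ * 2 ^ κ : ℕ) : ℤ)))
            (x₀ T : ((cubeSumCurve (p : ℚ)).baseChange K).toAffine.Point)
            (x : galH1Torsion ((cubeSumCurve (p : ℚ)).baseChange K) ((2 ^ κ * 2 ^ κ : ℕ) : ℤ))
            (cA : ℕ → galH1Torsion ((cubeSumCurve (3 * (p : ℚ) ^ 2)).baseChange K) ((2 ^ κ * 2 ^ κ : ℕ) : ℤ))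
            (cB : ℕ → galH1Torsion ((cubeSumCurve (p : ℚ)).baseChange K) ((2 ^ κ * 2 ^ κ : ℕ) : ℤ))
            (PA : selmerGroup ((cubeSumCurve (3 * (p : ℚ) ^ 2)).baseChange K) ((2 ^ κ * 2 ^ κ : ℕ) : ℤ) →+
              selmerGroup ((cubeSumCurve (3 * (p : ℚ) ^ 2)).baseChange K) ((2 ^ κ * 2 ^ κ : ℕ) : ℤ) →+
                AddCircle (1 : ℚ) × AddCircle (1 : ℚ))
            (PB : selmerGroup ((cubeSumCurve (p : ℚ)).baseChange K) ((2 ^ κ * 2 ^ κ : ℕ) : ℤ) →+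
              selmerGroup ((cubeSumCurve (p : ℚ)).baseChange K) ((2 ^ κ * 2 ^ κ : ℕ) : ℤ) →+
                AddCircle (1 : ℚ) × AddCircle (1 : ℚ))
            (sA : ℕ → galH1Torsion ((cubeSumCurve (3 * (p : ℚ) ^ 2)).baseChange K) ((2 ^ κ * 2 ^ κ : ℕ) : ℤ))
            (sB : ℕ → galH1Torsion ((cubeSumCurve (p : ℚ)).baseChange K) ((2 ^ κ * 2 ^ κ : ℕ) : ℤ))
            (N : ℕ → ℕ)
            (hselA : ∀ i, sA i ∈ selmerGroup ((cubeSumCurve (3 * (p : ℚ) ^ 2)).baseChange K)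
              ((2 ^ κ * 2 ^ κ : ℕ) : ℤ))
            (hselB : ∀ i, sB i ∈ selmerGroup ((cubeSumCurve (p : ℚ)).baseChange K) ((2 ^ κ * 2 ^ κ : ℕ) : ℤ))
            (hwSelA : ∀ s ∈ selmerGroup ((cubeSumCurve (3 * (p : ℚ) ^ 2)).baseChange K) ((2 ^ κ * 2 ^ κ : ℕ) : ℤ),
              wA s ∈ selmerGroup ((cubeSumCurve (3 * (p : ℚ) ^ 2)).baseChange K) ((2 ^ κ * 2 ^ κ : ℕ) : ℤ))
            (hwSelB : ∀ s ∈ selmerGroup ((cubeSumCurve (p : ℚ)).baseChange K) ((2 ^ κ * 2 ^ κ : ℕ) : ℤ),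
              wB s ∈ selmerGroup ((cubeSumCurve (p : ℚ)).baseChange K) ((2 ^ κ * 2 ^ κ : ℕ) : ℤ))
            (BA : AddCommGroup.primaryComponent ((cubeSumCurve (3 * (p : ℚ) ^ 2)).baseChange K).sha 2 →+
              AddCommGroup.primaryComponent ((cubeSumCurve (3 * (p : ℚ) ^ 2)).baseChange K).sha 2 →+
                AddCircle (1 : ℚ))
            (DA : AddSubgroup
              (AddCommGroup.primaryComponent ((cubeSumCurve (3 * (p : ℚ) ^ 2)).baseChange K).sha 2))
            (BB : AddCommGroup.primaryComponent ((cubeSumCurve (p : ℚ)).baseChange K).sha 2 →+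
              AddCommGroup.primaryComponent ((cubeSumCurve (p : ℚ)).baseChange K).sha 2 →+
                AddCircle (1 : ℚ))
            (DB : AddSubgroup (AddCommGroup.primaryComponent ((cubeSumCurve (p : ℚ)).baseChange K).sha 2)),
          (∀ ℓ, Kol ℓ → ℓ.Prime ∧ (Ideal.span {(ℓ : 𝓞 K)}).IsPrime) ∧ M₀ ≤ κ ∧
          -- (T-L5) the bottom class with provenance: `Y ↦ 2^{M₀} x₀ + T`, `x = δ_{2^κ·2^κ} x₀`, reading
          IsOfFinAddOrder T ∧
          Affine.Point.congrEquiv (congrArg (fun W : WeierstrassCurve ℚ ↦ W.baseChange K) hCB)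
              (VariableChange.pointEquivBaseChange B CB K Y) = (2 : ℤ) • (((2 ^ M₀ : ℕ) : ℤ) • x₀ + T) ∧
          x = kummerMapTorsion ((cubeSumCurve (p : ℚ)).baseChange K) ((2 ^ κ * 2 ^ κ : ℕ) : ℤ)
            (((cubeSumCurve (p : ℚ)).baseChange K).zsmul_geomPoints_surjective_of_charZero
              (Int.natCast_ne_zero.mpr (mul_ne_zero (pow_ne_zero κ two_ne_zero) (pow_ne_zero κ two_ne_zero)))) x₀ ∧
          ((2 : ℤ) ^ (2 * κ - 1)) • x ≠ 0 ∧ cB 1 = ((2 : ℤ) ^ M₀) • x ∧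
          2 * (M₀ : ℤ) ≤ padicValRat 2 (qB * qA) ∧
          (∀ n, KolSupp Kol n → Odd n.primeFactors.card → cA n ∈ AdmA) ∧
          (∀ n, KolSupp Kol n → Even n.primeFactors.card → cB n ∈ AdmB) ∧
          (∀ i, sA i ∈ AdmA) ∧ (∀ i, sB i ∈ AdmB) ∧
          -- the two FLIPs with multiples (memo (P2))
          (∀ ℓ m, Kol ℓ → KolSupp Kol (ℓ * m) → Even m.primeFactors.card →
            ∀ v : HeightOneSpectrum (𝓞 K), (ℓ : 𝓞 K) ∈ v.asIdeal → ∀ a : ℕ,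
            (((2 : ℤ) ^ a) • cA (ℓ * m) ∈ selmerLocalKer ((cubeSumCurve (3 * (p : ℚ) ^ 2)).baseChange K)
                (v.adicCompletion K) ((2 ^ κ * 2 ^ κ : ℕ) : ℤ) ↔
              ((2 : ℤ) ^ a) • cB m ∈ ((cubeSumCurve (p : ℚ)).baseChange K).torsionLocalKer
                (v.adicCompletion K) ((2 ^ κ * 2 ^ κ : ℕ) : ℤ))) ∧
          (∀ ℓ m, Kol ℓ → KolSupp Kol (ℓ * m) → Odd m.primeFactors.card →
            ∀ v : HeightOneSpectrum (𝓞 K), (ℓ : 𝓞 K) ∈ v.asIdeal → ∀ a : ℕ,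
            (((2 : ℤ) ^ a) • cB (ℓ * m) ∈ selmerLocalKer ((cubeSumCurve (p : ℚ)).baseChange K)
                (v.adicCompletion K) ((2 ^ κ * 2 ^ κ : ℕ) : ℤ) ↔
              ((2 : ℤ) ^ a) • cA m ∈ ((cubeSumCurve (3 * (p : ℚ) ^ 2)).baseChange K).torsionLocalKer
                (v.adicCompletion K) ((2 ^ κ * 2 ^ κ : ℕ) : ℤ))) ∧
          -- the Cassels–Tate value clauses (memo (P5)+(P6)+(P2)); then the MIXED Čebotarev clause (3.2″)
          (∀ ℓ m : ℕ, Kol ℓ → KolSupp Kol (ℓ * m) → ¬ ℓ ∣ m → Even m.primeFactors.card →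
            ∀ (j N' a b : ℕ)
            (t : galH1Torsion ((cubeSumCurve (3 * (p : ℚ) ^ 2)).baseChange K) ((2 ^ κ * 2 ^ κ : ℕ) : ℤ))
            (ht : t ∈ selmerGroup ((cubeSumCurve (3 * (p : ℚ) ^ 2)).baseChange K) ((2 ^ κ * 2 ^ κ : ℕ) : ℤ))
            (hz : ((2 : ℤ) ^ j) • cA (ℓ * m) ∈
              selmerGroup ((cubeSumCurve (3 * (p : ℚ) ^ 2)).baseChange K) ((2 ^ κ * 2 ^ κ : ℕ) : ℤ)),
            ((2 : ℤ) ^ N') • t = 0 →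
            (∀ q ∈ m.primeFactors, ∀ v : HeightOneSpectrum (𝓞 K), (q : 𝓞 K) ∈ v.asIdeal →
              t ∈ ((cubeSumCurve (3 * (p : ℚ) ^ 2)).baseChange K).torsionLocalKer
                (v.adicCompletion K) ((2 ^ κ * 2 ^ κ : ℕ) : ℤ)) →
            κ ≤ j → N' ≤ κ → N' ≤ j → a + b + 1 = N' →
            (∀ v : HeightOneSpectrum (𝓞 K), (ℓ : 𝓞 K) ∈ v.asIdeal → ((2 : ℤ) ^ (a + (j - N'))) • cB m ∉
              ((cubeSumCurve (p : ℚ)).baseChange K).torsionLocalKer (v.adicCompletion K)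
                ((2 ^ κ * 2 ^ κ : ℕ) : ℤ)) →
            (∀ v : HeightOneSpectrum (𝓞 K), (ℓ : 𝓞 K) ∈ v.asIdeal → ((2 : ℤ) ^ b) • t ∉
              ((cubeSumCurve (3 * (p : ℚ) ^ 2)).baseChange K).torsionLocalKer (v.adicCompletion K)
                ((2 ^ κ * 2 ^ κ : ℕ) : ℤ)) →
            PA ⟨_, hz⟩ ⟨t, ht⟩ ≠ 0) ∧
          (∀ ℓ m : ℕ, Kol ℓ → KolSupp Kol (ℓ * m) → ¬ ℓ ∣ m → Odd m.primeFactors.card →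
            ∀ (j N' a b : ℕ)
            (t : galH1Torsion ((cubeSumCurve (p : ℚ)).baseChange K) ((2 ^ κ * 2 ^ κ : ℕ) : ℤ))
            (ht : t ∈ selmerGroup ((cubeSumCurve (p : ℚ)).baseChange K) ((2 ^ κ * 2 ^ κ : ℕ) : ℤ))
            (hz : ((2 : ℤ) ^ j) • cB (ℓ * m) ∈
              selmerGroup ((cubeSumCurve (p : ℚ)).baseChange K) ((2 ^ κ * 2 ^ κ : ℕ) : ℤ)),
            ((2 : ℤ) ^ N') • t = 0 →
            (∀ q ∈ m.primeFactors, ∀ v : HeightOneSpectrum (𝓞 K), (q : 𝓞 K) ∈ v.asIdeal →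
              t ∈ ((cubeSumCurve (p : ℚ)).baseChange K).torsionLocalKer
                (v.adicCompletion K) ((2 ^ κ * 2 ^ κ : ℕ) : ℤ)) →
            κ ≤ j → N' ≤ κ → N' ≤ j → a + b + 1 = N' →
            (∀ v : HeightOneSpectrum (𝓞 K), (ℓ : 𝓞 K) ∈ v.asIdeal → ((2 : ℤ) ^ (a + (j - N'))) • cA m ∉
              ((cubeSumCurve (3 * (p : ℚ) ^ 2)).baseChange K).torsionLocalKer (v.adicCompletion K)
                ((2 ^ κ * 2 ^ κ : ℕ) : ℤ)) →
            (∀ v : HeightOneSpectrum (𝓞 K), (ℓ : 𝓞 K) ∈ v.asIdeal → ((2 : ℤ) ^ b) • t ∉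
              ((cubeSumCurve (p : ℚ)).baseChange K).torsionLocalKer (v.adicCompletion K)
                ((2 ^ κ * 2 ^ κ : ℕ) : ℤ)) →
            PB ⟨_, hz⟩ ⟨t, ht⟩ ≠ 0) ∧
          (∀ (TA : Finset (galH1Torsion ((cubeSumCurve (3 * (p : ℚ) ^ 2)).baseChange K) ((2 ^ κ * 2 ^ κ : ℕ) : ℤ)))
            (TB : Finset (galH1Torsion ((cubeSumCurve (p : ℚ)).baseChange K) ((2 ^ κ * 2 ^ κ : ℕ) : ℤ)))
            (gA : galH1Torsion ((cubeSumCurve (3 * (p : ℚ) ^ 2)).baseChange K) ((2 ^ κ * 2 ^ κ : ℕ) : ℤ))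
            (gB : galH1Torsion ((cubeSumCurve (p : ℚ)).baseChange K) ((2 ^ κ * 2 ^ κ : ℕ) : ℤ)),
            gA ∈ AdmA → gB ∈ AdmB → (↑TA : Set _) ⊆ AdmA → (↑TB : Set _) ⊆ AdmB → ∀ b : ℕ,
            ∃ ℓ, b < ℓ ∧ Kol ℓ ∧
            (∀ g ∈ AddSubgroup.closure (insert gA (insert (wA gA) ((TA : Set _) ∪ wA '' (TA : Set _)))),
              (∀ v : HeightOneSpectrum (𝓞 K), (ℓ : 𝓞 K) ∈ v.asIdeal →
                g ∈ ((cubeSumCurve (3 * (p : ℚ) ^ 2)).baseChange K).torsionLocalKer (v.adicCompletion K)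
                  ((2 ^ κ * 2 ^ κ : ℕ) : ℤ)) ↔
              g ∈ AddSubgroup.closure ((TA : Set _) ∪ wA '' (TA : Set _))) ∧
            (∀ g ∈ AddSubgroup.closure (insert gB (insert (wB gB) ((TB : Set _) ∪ wB '' (TB : Set _)))),
              (∀ v : HeightOneSpectrum (𝓞 K), (ℓ : 𝓞 K) ∈ v.asIdeal →
                g ∈ ((cubeSumCurve (p : ℚ)).baseChange K).torsionLocalKer (v.adicCompletion K)
                  ((2 ^ κ * 2 ^ κ : ℕ) : ℤ)) ↔
              g ∈ AddSubgroup.closure ((TB : Set _) ∪ wB '' (TB : Set _)))) ∧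
          -- the lifts: exact orders with room, `𝒪`-isotropy, `𝒪`-independence (with `x` on `B`)
          (∀ i, Odd i → ((2 : ℤ) ^ N i) • sA i = 0) ∧ (∀ i, Even i → ((2 : ℤ) ^ N i) • sB i = 0) ∧
          (∀ i ∈ Finset.Ioc 0 K₀, Odd i → N i ≠ 0 → ((2 : ℤ) ^ (N i - 1)) • sA i ≠ 0) ∧
          (∀ i ∈ Finset.Ioc 0 K₀, Even i → N i ≠ 0 → ((2 : ℤ) ^ (N i - 1)) • sB i ≠ 0) ∧
          (∀ i ∈ Finset.Ioc 0 K₀, N i ≤ κ) ∧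
          (∀ i i', Odd i → Odd i' → PA ⟨sA i, hselA i⟩ ⟨sA i', hselA i'⟩ = 0 ∧
            PA ⟨wA (sA i), hwSelA _ (hselA i)⟩ ⟨sA i', hselA i'⟩ = 0) ∧
          (∀ i i', Even i → Even i' → PB ⟨sB i, hselB i⟩ ⟨sB i', hselB i'⟩ = 0 ∧
            PB ⟨wB (sB i), hwSelB _ (hselB i)⟩ ⟨sB i', hselB i'⟩ = 0) ∧
          (∀ (α β : ℕ → ℤ),
            ∑ j ∈ (Finset.Ioc 0 K₀).filter (fun j ↦ Odd j), (α j • sA j + β j • wA (sA j)) = 0 →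
              ∀ j ∈ (Finset.Ioc 0 K₀).filter (fun j ↦ Odd j), α j • sA j + β j • wA (sA j) = 0) ∧
          (∀ (b c : ℤ) (α β : ℕ → ℤ),
            (b • x + c • wB x) +
                ∑ j ∈ (Finset.Ioc 0 K₀).filter (fun j ↦ Even j), (α j • sB j + β j • wB (sB j)) = 0 →
              b • x + c • wB x = 0 ∧
                ∀ j ∈ (Finset.Ioc 0 K₀).filter (fun j ↦ Even j), α j • sB j + β j • wB (sB j) = 0) ∧
          -- (T-L4) STRUCTURAL: (coiso) `D_X^⊥ ≤ D_X` on `Ш(X_K)[2^∞]`; (gen) `D_X` covered by the lifts' span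
          (∀ t, (∀ d ∈ DA, BA t d = 0) → t ∈ DA) ∧
          (∀ d ∈ DA, ∃ g ∈ AddSubgroup.closure
              (((((Finset.Ioc 0 K₀).filter (fun j ↦ Odd j)).image sA : Finset _) : Set _) ∪
                wA '' ((((Finset.Ioc 0 K₀).filter (fun j ↦ Odd j)).image sA : Finset _) : Set _)),
            torsionH1ToH1 ((cubeSumCurve (3 * (p : ℚ) ^ 2)).baseChange K) ((2 ^ κ * 2 ^ κ : ℕ) : ℤ) g =
              ((d : ((cubeSumCurve (3 * (p : ℚ) ^ 2)).baseChange K).sha) :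
                ((cubeSumCurve (3 * (p : ℚ) ^ 2)).baseChange K).galH1)) ∧
          (∀ t, (∀ d ∈ DB, BB t d = 0) → t ∈ DB) ∧
          (∀ d ∈ DB, ∃ g ∈ AddSubgroup.closure
              (((((Finset.Ioc 0 K₀).filter (fun j ↦ Even j)).image sB : Finset _) : Set _) ∪
                wB '' ((((Finset.Ioc 0 K₀).filter (fun j ↦ Even j)).image sB : Finset _) : Set _)),
            torsionH1ToH1 ((cubeSumCurve (p : ℚ)).baseChange K) ((2 ^ κ * 2 ^ κ : ℕ) : ℤ) g =
              ((d : ((cubeSumCurve (p : ℚ)).baseChange K).sha) :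
                ((cubeSumCurve (p : ℚ)).baseChange K).galH1))) :
    PublishedFactsTwoPlus →
    ∀ (p : ℕ), p.Prime → p % 9 = 7 → (¬ ∃ x : ZMod p, x ^ 3 = 3) →
      ∀ (A B : WeierstrassCurve ℚ) [A.IsElliptic] [A.IsGloballyMinimal] [B.IsElliptic]
        [B.IsGloballyMinimal], (∃ C : VariableChange ℚ, C • B = HuShuYin2019.cubeSumCurve (p : ℚ)) →
        (∃ C : VariableChange ℚ, C • A = HuShuYin2019.cubeSumCurve (3 * (p : ℚ) ^ 2)) →
        4 < Nat.card (AddCommGroup.primaryComponent B.sha 2) *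
            Nat.card (AddCommGroup.primaryComponent A.sha 2) →
        ∃ qB qA : ℚ, shaAn B = (qB : ℂ) ∧ shaAn A = (qA : ℂ) ∧ qB * qA ≠ 0 ∧
          (padicValNat 2 (Nat.card (AddCommGroup.primaryComponent B.sha 2)) : ℤ) +
              (padicValNat 2 (Nat.card (AddCommGroup.primaryComponent A.sha 2)) : ℤ) ≤
            padicValRat 2 (qB * qA) := by
  intro hF p hp h9 h3 A B _ _ _ _ hB hA h4
  -- the CM field `K = ℚ(ζ₃)` with `ω = ζ₃`
  haveI : IsCyclotomicExtension {3} ℚ (CyclotomicField 3 ℚ) :=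
    CyclotomicField.isCyclotomicExtension 3 ℚ
  obtain ⟨ω, hω⟩ : ∃ ω : CyclotomicField 3 ℚ, ω ^ 2 + ω + 1 = 0 := by
    have hζ := IsCyclotomicExtension.zeta_spec 3 ℚ (CyclotomicField 3 ℚ)
    refine ⟨IsCyclotomicExtension.zeta 3 ℚ (CyclotomicField 3 ℚ), ?_⟩
    have h1 : IsCyclotomicExtension.zeta 3 ℚ (CyclotomicField 3 ℚ) ≠ 1 := hζ.ne_one (by norm_num)
    have h3 : (IsCyclotomicExtension.zeta 3 ℚ (CyclotomicField 3 ℚ) - 1) *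
        (IsCyclotomicExtension.zeta 3 ℚ (CyclotomicField 3 ℚ) ^ 2 +
          IsCyclotomicExtension.zeta 3 ℚ (CyclotomicField 3 ℚ) + 1) = 0 := by
      linear_combination hζ.pow_eq_one
    exact (mul_eq_zero.mp h3).resolve_left (sub_ne_zero.mpr h1)
  have h2 : Module.finrank ℚ (CyclotomicField 3 ℚ) = 2 := by
    rw [IsCyclotomicExtension.finrank (n := 3) (K := ℚ) (CyclotomicField 3 ℚ)
      (Polynomial.cyclotomic.irreducible_rat (by norm_num)), Nat.totient_prime Nat.prime_three]
  -- the displayed values `qB = #Ш_an(B)`, `qA = #Ш_an(A)`, generator and Heegner point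
  obtain ⟨qB, qA, hqB, hqA, hne, -, P, Y, hPinf, hPgen, hht⟩ :=
    hF.2 p hp (Or.inr h9) h3 A B hB hA (CyclotomicField 3 ℚ) ω hω h2
  obtain ⟨CB, hCB⟩ := hB
  obtain ⟨CA, hCA⟩ := hA
  -- the leaves at `K = ℚ(ζ₃)`
  obtain ⟨κ, M₀, K₀, Kol, wA, wB, AdmA, AdmB, x₀, T, x, cA, cB, PA, PB, sA, sB, N, hselA, hselB,
    hwSelA, hwSelB, BA, DA, BB, DB, hKol, hκ, -, -, -, x_ord, c_one, hM₀, cA_adm, cB_adm, sA_adm, sB_adm,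
    flipA, flipB, hCTVA, hCTVB, hCeb, hNA, hNB, hNA', hNB', hroom, hisoA, hisoB, hindA, hindB, hcoA,
    hgenA, hcoB, hgenB⟩ :=
    hT hF p hp h9 h3 A B ⟨CB, hCB⟩ ⟨CA, hCA⟩ h4 qB qA hqB hqA hne (CyclotomicField 3 ℚ) ω hω h2 CB
      hCB P Y hPinf hPgen hht
  -- `H¹(K, X[2^κ·2^κ])` is killed by `2^{2κ}`
  have h2κ : ((2 : ℤ) ^ (2 * κ)) = ((2 ^ κ * 2 ^ κ : ℕ) : ℤ) := by push_cast; ring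
  have hMA : ∀ v : galH1Torsion ((cubeSumCurve (3 * (p : ℚ) ^ 2)).baseChange (CyclotomicField 3 ℚ))
      ((2 ^ κ * 2 ^ κ : ℕ) : ℤ), ((2 : ℤ) ^ (2 * κ)) • v = 0 := fun v ↦ by
    rw [h2κ]; exact zsmul_galH1Torsion_eq_zero _ ((2 ^ κ * 2 ^ κ : ℕ) : ℤ) v
  have hMB : ∀ v : galH1Torsion ((cubeSumCurve (p : ℚ)).baseChange (CyclotomicField 3 ℚ))
      ((2 ^ κ * 2 ^ κ : ℕ) : ℤ), ((2 : ℤ) ^ (2 * κ)) • v = 0 := fun v ↦ by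
    rw [h2κ]; exact zsmul_galH1Torsion_eq_zero _ ((2 ^ κ * 2 ^ κ : ℕ) : ℤ) v
  -- THEOREM K3's "≤" half on the tree's objects, κ-narrowed leaves at `M := 2κ` (§4κ)
  have hsum : ∑ i ∈ Finset.Ioc 0 K₀, N i ≤ M₀ :=
    sum_le_M₀_of_coupledLeaves_kappa (cubeSumCurve (3 * (p : ℚ) ^ 2)) (cubeSumCurve (p : ℚ)) _ (2 * κ)
      M₀ κ hκ hMA hMB Kol hKol wA wB hwSelA hwSelB AdmA AdmB x_ord cA cB c_one cA_adm cB_adm flipA flipB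
      PA PB (fun ℓ m hℓ hs hnd he j N₁ a b t ht hz hN hq h1 h2 h3 ↦ hCTVA ℓ m hℓ hs hnd he j N₁ a b t ht
        hz hN hq (by omega) (by omega) h3) (fun ℓ m hℓ hs hnd ho j N₁ a b t ht hz hN hq h1 h2 h3 ↦
        hCTVB ℓ m hℓ hs hnd ho j N₁ a b t ht hz hN hq (by omega) (by omega) h3) hCeb K₀ sA sB N hselA
      hselB sA_adm sB_adm hNA hNB hNA' hNB' (fun i hi ↦ by have := hroom i hi; omega) hisoA hisoB
      hindA hindB
  -- the tail's guard: both `ℚ`-sides are non-trivial, so finite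
  have hBne : Nat.card (AddCommGroup.primaryComponent B.sha 2) ≠ 0 := fun h ↦ by
    rw [h, zero_mul] at h4
    exact Nat.not_lt_zero _ h4
  have hAne : Nat.card (AddCommGroup.primaryComponent A.sha 2) ≠ 0 := fun h ↦ by
    rw [h, mul_zero] at h4
    exact Nat.not_lt_zero _ h4
  -- LEMMA K0, order form (k-ty1/g19): `#Ш(X_K)[2^∞] = (#Ш(X/ℚ)[2^∞])²` on the short models
  have hKB : Nat.card (AddCommGroup.primaryComponent
      ((cubeSumCurve (p : ℚ)).baseChange (CyclotomicField 3 ℚ)).sha 2) =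
      Nat.card (AddCommGroup.primaryComponent B.sha 2) ^ 2 :=
    SylvesterTwoShaDescentOrderForm.natCard_primaryComponent_sha_baseChange_eq_sq_of_omega
      (CyclotomicField 3 ℚ) (b := -432 * (p : ℚ) ^ 2) hCB hω h2
  have hKA : Nat.card (AddCommGroup.primaryComponent
      ((cubeSumCurve (3 * (p : ℚ) ^ 2)).baseChange (CyclotomicField 3 ℚ)).sha 2) =
      Nat.card (AddCommGroup.primaryComponent A.sha 2) ^ 2 :=
    SylvesterTwoShaDescentOrderForm.natCard_primaryComponent_sha_baseChange_eq_sq_of_omega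
      (CyclotomicField 3 ℚ) (b := -432 * (3 * (p : ℚ) ^ 2) ^ 2) hCA hω h2
  haveI : Finite (AddCommGroup.primaryComponent
      ((cubeSumCurve (p : ℚ)).baseChange (CyclotomicField 3 ℚ)).sha 2) :=
    Nat.finite_of_card_ne_zero (by rw [hKB]; exact pow_ne_zero 2 hBne)
  haveI : Finite (AddCommGroup.primaryComponent
      ((cubeSumCurve (3 * (p : ℚ) ^ 2)).baseChange (CyclotomicField 3 ℚ)).sha 2) :=
    Nat.finite_of_card_ne_zero (by rw [hKA]; exact pow_ne_zero 2 hAne)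
  -- (coiso): `#Ш(X_K)[2^∞] ≤ (#D_X)²`
  have hcoB' := natCard_le_sq_of_coisotropic BB DB hcoB
  have hcoA' := natCard_le_sq_of_coisotropic BA DA hcoA
  -- the `𝒪`-spans of the lifts are finite of order `≤ 4^{Σ_X N i}`
  obtain ⟨hfinB, hspanB⟩ := finite_and_natCard_closure_le wB sB (fun i ↦ 2 ^ N i)
    ((Finset.Ioc 0 K₀).filter (fun j ↦ Even j)) (fun i _ ↦ by positivity)
    (fun i hi ↦ by exact_mod_cast hNB i (Finset.mem_filter.mp hi).2)
  obtain ⟨hfinA, hspanA⟩ := finite_and_natCard_closure_le wA sA (fun i ↦ 2 ^ N i)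
    ((Finset.Ioc 0 K₀).filter (fun j ↦ Odd j)) (fun i _ ↦ by positivity)
    (fun i hi ↦ by exact_mod_cast hNA i (Finset.mem_filter.mp hi).2)
  -- (gen): `#D_X ≤ #(𝒪-span of the lifts)` (an injection `D_X ↪ span` through `torsionH1ToH1`)
  have hDB : Nat.card DB ≤ Nat.card (AddSubgroup.closure
      (((((Finset.Ioc 0 K₀).filter (fun j ↦ Even j)).image sB : Finset _) : Set _) ∪
        wB '' ((((Finset.Ioc 0 K₀).filter (fun j ↦ Even j)).image sB : Finset _) : Set _))) := by
    haveI := hfinB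
    choose g hg hgeq using hgenB
    refine Nat.card_le_card_of_injective (fun d : DB ↦ (⟨g d.1 d.2, hg d.1 d.2⟩ : AddSubgroup.closure
      (((((Finset.Ioc 0 K₀).filter (fun j ↦ Even j)).image sB : Finset _) : Set _) ∪
        wB '' ((((Finset.Ioc 0 K₀).filter (fun j ↦ Even j)).image sB : Finset _) : Set _))))
      fun d₁ d₂ h ↦ ?_
    have h' := congrArg (fun z : AddSubgroup.closure
      (((((Finset.Ioc 0 K₀).filter (fun j ↦ Even j)).image sB : Finset _) : Set _) ∪
        wB '' ((((Finset.Ioc 0 K₀).filter (fun j ↦ Even j)).image sB : Finset _) : Set _)) ↦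
      torsionH1ToH1 _ _ (z : galH1Torsion ((cubeSumCurve (p : ℚ)).baseChange (CyclotomicField 3 ℚ))
        ((2 ^ κ * 2 ^ κ : ℕ) : ℤ))) h
    simp only [hgeq] at h'
    exact Subtype.ext (Subtype.ext (Subtype.ext h'))
  have hDA : Nat.card DA ≤ Nat.card (AddSubgroup.closure
      (((((Finset.Ioc 0 K₀).filter (fun j ↦ Odd j)).image sA : Finset _) : Set _) ∪
        wA '' ((((Finset.Ioc 0 K₀).filter (fun j ↦ Odd j)).image sA : Finset _) : Set _))) := by
    haveI := hfinA
    choose g hg hgeq using hgenA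
    refine Nat.card_le_card_of_injective (fun d : DA ↦ (⟨g d.1 d.2, hg d.1 d.2⟩ : AddSubgroup.closure
      (((((Finset.Ioc 0 K₀).filter (fun j ↦ Odd j)).image sA : Finset _) : Set _) ∪
        wA '' ((((Finset.Ioc 0 K₀).filter (fun j ↦ Odd j)).image sA : Finset _) : Set _))))
      fun d₁ d₂ h ↦ ?_
    have h' := congrArg (fun z : AddSubgroup.closure
      (((((Finset.Ioc 0 K₀).filter (fun j ↦ Odd j)).image sA : Finset _) : Set _) ∪
        wA '' ((((Finset.Ioc 0 K₀).filter (fun j ↦ Odd j)).image sA : Finset _) : Set _)) ↦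
      torsionH1ToH1 _ _ (z : galH1Torsion ((cubeSumCurve (3 * (p : ℚ) ^ 2)).baseChange
        (CyclotomicField 3 ℚ)) ((2 ^ κ * 2 ^ κ : ℕ) : ℤ))) h
    simp only [hgeq] at h'
    exact Subtype.ext (Subtype.ext (Subtype.ext h'))
  -- counting: `(#Ш(X/ℚ)[2^∞])² ≤ (4^{Σ_X})²`, hence `s_X ≤ 2 Σ_X N i`
  have hprodB : (∏ i ∈ (Finset.Ioc 0 K₀).filter (fun j ↦ Even j), 2 ^ N i) =
      2 ^ ∑ i ∈ (Finset.Ioc 0 K₀).filter (fun j ↦ Even j), N i := Finset.prod_pow_eq_pow_sum _ _ _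
  have hprodA : (∏ i ∈ (Finset.Ioc 0 K₀).filter (fun j ↦ Odd j), 2 ^ N i) =
      2 ^ ∑ i ∈ (Finset.Ioc 0 K₀).filter (fun j ↦ Odd j), N i := Finset.prod_pow_eq_pow_sum _ _ _
  have hleB : Nat.card (AddCommGroup.primaryComponent B.sha 2) ≤
      2 ^ (2 * ∑ i ∈ (Finset.Ioc 0 K₀).filter (fun j ↦ Even j), N i) := by
    have h := hKB.symm.trans_le (hcoB'.trans (Nat.pow_le_pow_left (hDB.trans hspanB) 2))
    rw [hprodB] at h
    have h' := (Nat.pow_le_pow_iff_left two_ne_zero).mp h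
    rwa [← pow_mul, mul_comm] at h'
  have hleA : Nat.card (AddCommGroup.primaryComponent A.sha 2) ≤
      2 ^ (2 * ∑ i ∈ (Finset.Ioc 0 K₀).filter (fun j ↦ Odd j), N i) := by
    have h := hKA.symm.trans_le (hcoA'.trans (Nat.pow_le_pow_left (hDA.trans hspanA) 2))
    rw [hprodA] at h
    have h' := (Nat.pow_le_pow_iff_left two_ne_zero).mp h
    rwa [← pow_mul, mul_comm] at h'
  have hsB := padicValNat_two_le_of_le_pow hBne hleB
  have hsA := padicValNat_two_le_of_le_pow hAne hleA
  have hsplit : ∑ i ∈ (Finset.Ioc 0 K₀).filter (fun j ↦ Even j), N i +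
      ∑ i ∈ (Finset.Ioc 0 K₀).filter (fun j ↦ Odd j), N i = ∑ i ∈ Finset.Ioc 0 K₀, N i := by
    rw [← Finset.sum_filter_add_sum_filter_not (Finset.Ioc 0 K₀) (fun j ↦ Even j) N]
    congr 2
    exact Finset.filter_congr fun j _ ↦ Nat.not_even_iff_odd.symm
  refine ⟨qB, qA, hqB, hqA, hne, ?_⟩
  have hcast : ((∑ i ∈ Finset.Ioc 0 K₀, N i : ℕ) : ℤ) ≤ (M₀ : ℤ) := by exact_mod_cast hsum
  have hsum2 : (padicValNat 2 (Nat.card (AddCommGroup.primaryComponent B.sha 2)) : ℤ) +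
      (padicValNat 2 (Nat.card (AddCommGroup.primaryComponent A.sha 2)) : ℤ) ≤
      2 * ((∑ i ∈ Finset.Ioc 0 K₀, N i : ℕ) : ℤ) := by
    rw [← hsplit]
    push_cast
    linarith [(Nat.cast_le (α := ℤ)).mpr hsB, (Nat.cast_le (α := ℤ)).mpr hsA]
  linarith

end TailKappa

end Summit.BirchSwinnertonDyer.BirchSwinnertonDyer.Theorems.SylvesterTwoCoupledTelescope

end
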